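import Summits.QuantumAdvantage.QuantumAdvantage.Theorems.MobiusLadderLiouvilleNotPPolyOneTimePad
import Literature.Computability.Complexity.LupanovBound
import Literature.Computability.Complexity.AdderBlocks
import Literature.Computability.Complexity.CircuitClassesProofs
import HarnessLib

/-!
# Crux `MobiusLadder.LiouvilleNotPPoly` (stmt-QuantumAdvantage-1389), line `SketchIdeator4`,
# stub T3′ `stub_factoringAvgHard`

**Factoring inherits the `1/poly` average-case hardness.** A multi-output `B₂`-circuit `F` of size
`≤ p(n)` reads the `n` digits of an instance `N ∈ [2^{n-1}, 2^n)` and writes `n` slots of `n` bits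
each (numbers via `ofBits`); it SUCCEEDS on `N` when its nonzero slots are a permutation of
`N.primeFactorsList` (the prime factorisation with multiplicity). Under `MildAvgHard c` the number
`S` of successes obeys `n^c · S ≤ (n^c − 1) · 2^{n-1}`.

Proof. (1) From `F` build the single-output function
`G(x) = ⊕_i [slot i of F(x) is nonzero]`, "slot nonzero" being the OR of its `n` bits (an OR
chain of `n + 1` gates, `cktSize_exists`/`cktSize_slotNonzero`) and `⊕` the XOR chain `parityFin`
(`n + 1` gates, `cktSize_parityFin`); by the tree's straight-line calculus (`CktSize.comp`, `CktSize.pi_const`,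
`CktSize.toCircuit`) `G` is a `B₂`-circuit `C` of size `≤ p(n) + n(n+1) + (n+1) = (p + X² + 2X + 1)(n)`.
(2) On a success `N`, the number of nonzero slots is `|N.primeFactorsList| = Ω(N)`
(`List.Perm.length_eq`, `ArithmeticFunction.cardFactors_apply`), so `C(bits N)` is the parity of
`Ω(N)`, i.e. `[λ(N) = -1] = lamBit N` (`ArithmeticFunction.liouville_apply`): the successes are
disjoint from the disagreement set, `S + disagree n C ≤ 2^{n-1}`. (3) `MildAvgHard c` at the size
polynomial `p + X² + 2X + 1` gives `2^{n-1} ≤ n^c · disagree n C`, whence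
`n^c S ≤ n^c (2^{n-1} − disagree n C) ≤ (n^c − 1) 2^{n-1}`.

Sources: folklore (`Ω(N) = |primeFactorsList N|`, parity/OR chains); H. Vollmer, *Introduction to
Circuit Complexity* (1999), §1.2 (composition of circuits) for the conventions of the tree's `CktSize`.
-/

set_option linter.dupNamespace false -- D-0017: single-problem summit ⇒ `QuantumAdvantage.QuantumAdvantage` by design

noncomputable section

namespace Summit.QuantumAdvantage.QuantumAdvantage.Theorems.LiouvilleNotPPoly.OneTimePad

open Literature.Computability.Complexity
open Literature.Probability.RandomGraphs.LowDegree (sgn sgn_true sgn_false)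
open _root_.Computability Filter Finset Polynomial
open Summit.QuantumAdvantage.QuantumAdvantage.Theorems.MobiusLadder
open Summit.QuantumAdvantage.QuantumAdvantage.Theorems.LiouvilleOrthogonalTC0 (bits ofBits lamBit)

namespace FactoringAvgHard

/-! ### OR chains -/

/-- "Some of the `M` bits is set", `[∃ j, z_j]`, costs `M + 1` gates over `B₂`: a chain of binary OR
gates after the constant `0` (companion of the XOR chain `cktSize_parityFin`; Vollmer 1999, §1.2).
[folklore] -/
theorem cktSize_exists : ∀ M : ℕ,
    CktSize B2 (fun (z : Fin M → Bool) (_ : Unit) => decide (∃ j, z j = true)) (M + 1)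
  | 0 => (cktSize_const (Fin 0) false).congr fun z u => by simp
  | M + 1 => by
    have hA : CktSize B2 (fun (z : Fin (M + 1) → Bool) =>
        Sum.elim (fun (_ : Unit) => decide (∃ j : Fin M, z j.castSucc = true))
          (fun (_ : Unit) => z (Fin.last M))) ((M + 1) + 0) :=
      ((cktSize_exists M).rewire Fin.castSucc).pair
        ((CktSize.proj B2 fun _ : Unit => Fin.last M).congr fun _ _ => rfl)
    have hB := cktSize_or (ι := Unit ⊕ Unit) (.inl ()) (.inr ())
    exact ((hA.comp hB).of_le (by omega)).congr fun z u => by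
      rw [Sum.elim_inl, Sum.elim_inr, Bool.eq_iff_iff]
      simp [Fin.exists_fin_succ']

/-- A number is nonzero iff one of its binary digits is set: `ofBits s ≠ 0 ↔ ∃ j, s j`. [folklore] -/
theorem ofBits_ne_zero_iff {n : ℕ} (s : Fin n → Bool) : ofBits s ≠ 0 ↔ ∃ j, s j = true := by
  simp [ofBits, Finset.sum_eq_zero_iff]

/-- The bit "the slot is nonzero" (`ofBits s ≠ 0`) on the `n` digits `s` of a slot costs `n + 1` gates
over `B₂` (the OR chain of the digits). [folklore] -/
theorem cktSize_slotNonzero (n : ℕ) :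
    CktSize B2 (fun (s : Fin n → Bool) (_ : Unit) => decide (ofBits s ≠ 0)) (n + 1) :=
  (cktSize_exists n).congr fun s _ => decide_eq_decide.2 (ofBits_ne_zero_iff s).symm

/-! ### Parity chains count modulo `2` -/

/-- The XOR chain of the bits `[p (f j)]`, `j < M`, is the parity of the number of indices `j` with
`p (f j)`, i.e. of the length of the list `(f 0, …, f (M-1))` filtered by `p`. [folklore] -/
theorem parityFin_ofFn_filter {α : Type*} (p : α → Bool) : ∀ (M : ℕ) (f : Fin M → α),
    parityFin M (fun j => p (f j)) = decide (Odd ((List.ofFn f).filter p).length)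
  | 0, f => by simp [parityFin]
  | M + 1, f => by
    rw [parityFin, parityFin_ofFn_filter p M (fun j => f j.castSucc), List.ofFn_succ',
      List.concat_eq_append, List.filter_append, List.length_append]
    cases h : p (f (Fin.last M))
    · simp [h]
    · simp only [h, List.filter_cons_of_pos, List.filter_nil, List.length_cons, List.length_nil,
        zero_add, Bool.xor_true, Nat.odd_add_one, decide_not]

/-- **Parity of the number of nonzero slots on a success.** If the nonzero entries of
`slots : Fin n → ℕ` are a permutation of the prime factorisation of `N ≠ 0` (with multiplicity),
then the parity of their number is the parity of `Ω(N)`, i.e. the bit `lamBit N = [λ(N) = -1]`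
(`λ(N) = (-1)^{Ω(N)}`, `Ω(N) = |primeFactorsList N|`). [folklore] -/
theorem parity_slots_eq_lamBit {n N : ℕ} (hN : N ≠ 0) (slots : Fin n → ℕ)
    (hperm : ((List.ofFn slots).filter (· ≠ 0)).Perm N.primeFactorsList) :
    parityFin n (fun i => decide (slots i ≠ 0)) = lamBit N := by
  have h1 : parityFin n (fun i => decide (slots i ≠ 0)) =
      decide (Odd ((List.ofFn slots).filter (· ≠ 0)).length) :=
    parityFin_ofFn_filter (fun s : ℕ => decide (s ≠ 0)) n slots
  rw [h1, hperm.length_eq, ← ArithmeticFunction.cardFactors_apply]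
  unfold lamBit
  rw [ArithmeticFunction.liouville_apply hN]
  exact (decide_eq_decide.2 (neg_one_pow_eq_neg_one_iff_odd (by decide))).symm

end FactoringAvgHard

open FactoringAvgHard

/-- **T3′ · factoring inherits the `1/poly` average-case hardness (the non-uniform core of the OWF
calibration T3).** A multi-output `B₂`-circuit `F` of size `≤ p(n)` on the `n` digits of an instance
`N ∈ [2^{n-1}, 2^n)`, writing `n` slots of `n` bits each, SUCCEEDS on `N` when its nonzero slots are
the prime factorisation of `N` with multiplicity (a permutation of `N.primeFactorsList`). Under
`MildAvgHard c` the success count `S` obeys `n^c · S ≤ (n^c − 1) 2^{n-1}`, i.e. `F` fails on at least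
a `n^{-c}` fraction: the parity of the number of nonzero slots is a `B₂`-circuit of size
`≤ p(n) + n(n+1) + (n+1)` computing `[λ(N) = -1]` wherever `F` succeeds (`Ω(N) = |primeFactorsList N|`).
[folklore] -/
theorem stub_factoringAvgHard :
    ∀ c : ℕ, MildAvgHard c → ∀ p : Polynomial ℕ, ∀ᶠ n : ℕ in atTop,
      ∀ F : (Fin n → Bool) → Fin n × Fin n → Bool, CktSize B2 F (p.eval n) →
        (n : ℝ) ^ c *
            (((Finset.Ico (2 ^ (n - 1)) (2 ^ n)).filter fun N =>
                ((List.ofFn fun i : Fin n => ofBits fun j : Fin n => F (bits n N) (i, j)).filter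
                    (· ≠ 0)).Perm N.primeFactorsList).card : ℝ) ≤
          ((n : ℝ) ^ c - 1) * (2 : ℝ) ^ (n - 1) := by
  intro c hc p
  filter_upwards [hc (p + (X ^ 2 + X + X + 1)), eventually_ge_atTop 1] with n hn hn1
  intro F hF
  obtain ⟨k, rfl⟩ : ∃ k, n = k + 1 := ⟨n - 1, by omega⟩
  simp only [Nat.add_sub_cancel] at hn ⊢
  -- (1) the parity-of-nonzero-slots circuit: `F`, then `n` OR chains, then one XOR chain
  have hH : CktSize B2 (fun (y : Fin (k + 1) × Fin (k + 1) → Bool) (i : Fin (k + 1)) =>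
      decide (ofBits (fun j => y (i, j)) ≠ 0)) (Fintype.card (Fin (k + 1)) * (k + 1 + 1)) :=
    CktSize.pi_const fun i => (cktSize_slotNonzero (k + 1)).rewire fun j => (i, j)
  have hG := (hF.comp hH).comp (cktSize_parityFin (k + 1))
  have hsize : p.eval (k + 1) + Fintype.card (Fin (k + 1)) * (k + 1 + 1) + (k + 1 + 1) ≤
      (p + (X ^ 2 + X + X + 1)).eval (k + 1) := by
    simp only [Fintype.card_fin, eval_add, eval_pow, eval_X, eval_one]
    nlinarith
  obtain ⟨C, hCB, hCs, hCe⟩ := (hG.of_le hsize).toCircuit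
  have hMild : (2 : ℝ) ^ k ≤ ((k + 1 : ℕ) : ℝ) ^ c * (disagree (k + 1) C : ℝ) :=
    hn C hCB hCs
  -- (2) wherever `F` succeeds, `C` outputs `lamBit N`
  have hagree : ∀ N : ℕ, 2 ^ k ≤ N →
      ((List.ofFn fun i : Fin (k + 1) => ofBits fun j : Fin (k + 1) =>
          F (bits (k + 1) N) (i, j)).filter (· ≠ 0)).Perm N.primeFactorsList →
        C.eval (bits (k + 1) N) = lamBit N := by
    intro N hN hperm
    have hN0 : N ≠ 0 := by
      have := Nat.one_le_two_pow (n := k)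
      omega
    rw [hCe]
    exact parity_slots_eq_lamBit hN0 _ hperm
  -- (3) counting: successes and disagreements are disjoint sets of instances
  have key : ∀ S : Finset ℕ,
      S ⊆ (Finset.Ico (2 ^ k) (2 ^ (k + 1))).filter
          (fun N => C.eval (bits (k + 1) N) = lamBit N) →
        ((k + 1 : ℕ) : ℝ) ^ c * (S.card : ℝ) ≤
          (((k + 1 : ℕ) : ℝ) ^ c - 1) * (2 : ℝ) ^ k := by
    intro S hS
    have hdis : S.card + disagree (k + 1) C ≤ 2 ^ k := by
      have hD : disagree (k + 1) C =
          ((Finset.Ico (2 ^ k) (2 ^ (k + 1))).filter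
            fun N => C.eval (bits (k + 1) N) ≠ lamBit N).card := by
        simp only [disagree, Nat.add_sub_cancel]
      rw [hD, ← Finset.card_union_of_disjoint ?_]
      · calc _ ≤ (Finset.Ico (2 ^ k) (2 ^ (k + 1))).card :=
              Finset.card_le_card (Finset.union_subset (hS.trans (Finset.filter_subset _ _))
                (Finset.filter_subset _ _))
          _ = 2 ^ k := by
            rw [Nat.card_Ico, pow_succ]
            omega
      · rw [Finset.disjoint_left]
        intro N hNS hND
        exact (Finset.mem_filter.1 hND).2 (Finset.mem_filter.1 (hS hNS)).2
    have hdisR : (S.card : ℝ) + (disagree (k + 1) C : ℝ) ≤ (2 : ℝ) ^ k := by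
      exact_mod_cast hdis
    have hpos : (0 : ℝ) ≤ ((k + 1 : ℕ) : ℝ) ^ c := by positivity
    have h1 : ((k + 1 : ℕ) : ℝ) ^ c * (S.card : ℝ) ≤
        ((k + 1 : ℕ) : ℝ) ^ c * ((2 : ℝ) ^ k - (disagree (k + 1) C : ℝ)) :=
      mul_le_mul_of_nonneg_left (by linarith) hpos
    rw [mul_sub] at h1
    linarith
  apply key
  intro N hN
  rw [Finset.mem_filter] at hN ⊢
  exact ⟨hN.1, hagree N (Finset.mem_Ico.1 hN.1).1 hN.2⟩

end Summit.QuantumAdvantage.QuantumAdvantage.Theorems.LiouvilleNotPPoly.OneTimePad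

end
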